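import Summits.Langlands.Langlands.Theorems.FrobeniusMomentIrreducibilityAutomorphicBound
import Summits.Langlands.Langlands.Theorems.FrobeniusMomentIrreducibilityGaloisBlocks
import HarnessLib

/-!
# Route `FrobeniusMomentIrreducibility`, item `IrreducibleOfMoments` (stmt-Langlands-19275) — part 3/3:
# the Rankin-type irreducibility criterion (route glue, PROVED)

`IrreducibleOfMoments : MeanSquareTraceAtLeastOne → TraceCorrelationNonneg → PairLPoleJS →
IrreduciblePureCompatible`: GIVEN the route's three cruxes as hypotheses — (A) a pure de Rham
`m`-dimensional `ρ` has `∑_v |ι tr ρ(Frob_v)|² q_v^{-w-σ} ≥ (1-ε) log 1/(σ-1)`, (B) the cross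
correlation of two such is `≥ -ε log 1/(σ-1)`, (JS) `L^S(s, π × π^∨)` has a simple pole at `s = 1` —
an `ℓ`-adic `ρ : Γ_F → GL_n(ℚ̄_ℓ)` which is Satake–Frobenius compatible with a cuspidal `π` at almost
all places, de Rham at `v ∣ ℓ` and pure of some weight `w`, is irreducible.

Proof (J.-P. Serre's Rankin-type criterion, *Abelian ℓ-adic representations* I.2 with Jacquet–Shalika):
if not, the continuous dévissage (part 2, `exists_blocks_of_not_irreducible`) gives blocks `ρ₁`, `ρ₂`
of positive ranks, unramified / de Rham / pure like `ρ`, with `tr ρ = tr ρ₁ + tr ρ₂` at the unramified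
places; (A)+(A)+2(B) give `∑_v |ι tr ρ(Frob_v)|² q_v^{-w-σ} ≥ (2 - 4ε) log 1/(σ-1) - O(1)`, whereas
compatibility + purity + unitarity of the central character identify `|ι tr ρ(Frob_v)|² q_v^{-w}` with
`|∑ α_P(v)|²` for the unitary normalisation `α_P` of the Satake parameters of `π` (part 2,
`normSq_frobTrace_mul_rpow_eq`), whose first moment is `≤ log 1/(σ-1) + O(1)` by the pole hypothesis
(part 1, `exists_unitary_normalisation_bound`).  With `ε = 1/8` this is absurd as `σ → 1⁺`
(`false_of_moment_inequalities`, elementary real analysis).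

References: J.-P. Serre, *Abelian ℓ-adic representations* (1968), I.2.3 and the Rankin argument of
I.A.2; H. Jacquet, J. Shalika, Amer. J. Math. 103 (1981), Prop. (3.6), (5.3.3); R. Taylor, *Galois
representations*, Ann. Fac. Sci. Toulouse 13 (2004), §1 (irreducibility of automorphic Galois
representations via `L(s, π × π^∨)`).
-/

noncomputable section

set_option linter.dupNamespace false -- project-wide option (lakefile weak.linter.dupNamespace); `Summit.Langlands.Langlands` is the mandated namespace

open scoped NumberField ComplexConjugate Topology
open Filter IsDedekindDomain Polynomial
open Literature.NumberTheory.Automorphic Literature.NumberTheory.GaloisRepresentations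

namespace Summit.Langlands.Langlands.Theorems.FrobeniusMomentIrreducibilityIrreducibleOfMoments

/-! ### §1 The elementary real analysis -/

/-- **A family whose weighted sums dominate `(7/8) log 1/(σ-1)` near `σ = 1` is summable for every
`σ > 1`.**  If `∑'_v a_v N_v^{-(w+σ)} ≥ (1 - 1/8) log 1/(σ-1)` for all `σ` near `1⁺` (with Lean's
`∑' = 0` for non-summable families), then `v ↦ a_v N_v^{-(w+σ)}` is summable for every `σ > 1`:
otherwise, by comparison (`N_v ≥ 1`), it is non-summable for all smaller `σ`, the `∑'` vanish there,
and `log 1/(σ-1) > 0` near `1` is contradicted. [folklore] -/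
theorem summable_of_eventually_log_le_tsum {V : Type} (N : V → ℝ) (hN : ∀ v, 1 ≤ N v) (w : ℝ)
    (a : V → ℝ) (ha : ∀ v, 0 ≤ a v)
    (h : ∀ᶠ σ : ℝ in 𝓝[>] (1 : ℝ),
      (1 - 1 / 8) * Real.log (1 / (σ - 1)) ≤ ∑' v, a v * N v ^ (-(w + σ))) :
    ∀ σ : ℝ, 1 < σ → Summable fun v => a v * N v ^ (-(w + σ)) := by
  intro σ₁ hσ₁
  by_contra hns
  have hns' : ∀ σ : ℝ, σ ≤ σ₁ → ¬ Summable fun v => a v * N v ^ (-(w + σ)) := by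
    intro σ hσ hs
    refine hns (hs.of_nonneg_of_le (fun v => mul_nonneg (ha v)
      (Real.rpow_nonneg (zero_le_one.trans (hN v)) _)) fun v => ?_)
    exact mul_le_mul_of_nonneg_left (Real.rpow_le_rpow_of_exponent_le (hN v) (by linarith)) (ha v)
  have hev : ∀ᶠ σ : ℝ in 𝓝[>] (1 : ℝ), False := by
    filter_upwards [h, Ioo_mem_nhdsGT (show (1 : ℝ) < min σ₁ 2 from lt_min hσ₁ one_lt_two)]
      with σ hle hσ
    rw [tsum_eq_zero_of_not_summable
      (hns' σ (hσ.2.le.trans (min_le_left _ _)))] at hle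
    have h2 : σ < 2 := hσ.2.trans_le (min_le_right _ _)
    have hL : 0 < Real.log (1 / (σ - 1)) := by
      apply Real.log_pos
      rw [lt_div_iff₀ (by linarith [hσ.1]), one_mul]
      linarith
    linarith
  exact hev.exists.elim fun _ h => h

/-- **The contradiction.**  Abstract real-analysis core of the Rankin-type criterion: with
`L(σ) = log 1/(σ-1)`, weights `N_v ≥ 1`, block traces `t₁, t₂` with `t = t₁ + t₂` off a finite set
`T'`, block moments `≥ (7/8) L`, cross term `≥ -L/8`, and the total `∑_{v ∉ T'} |t_v|² N_v^{-(w+σ)}`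
identified termwise with a family whose first moment off `T ⊆ T'` is `≤ L + C`: impossible, since
`|t₁ + t₂|² = |t₁|² + |t₂|² + 2 Re(t₁ t̄₂)` gives `(3/2) L - O(1) ≤ L + O(1)` as `σ → 1⁺`.
[cite: SerreAbelianLadic1968, I.2.3] -/
theorem false_of_moment_inequalities {V : Type} (N : V → ℝ) (hN : ∀ v, 1 ≤ N v) (w : ℝ)
    (t t₁ t₂ : V → ℂ) (u : V → ℝ) (hu0 : ∀ v, 0 ≤ u v) (T T' : Finset V) (hTT' : T ⊆ T')
    (C : ℝ) (ht : ∀ v ∉ T', t v = t₁ v + t₂ v)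
    (hu : ∀ v ∉ T', ∀ σ : ℝ, ‖t v‖ ^ 2 * N v ^ (-(w + σ)) = u v * N v ^ (-σ))
    (husum : ∀ σ : ℝ, 1 < σ →
      Summable fun v : {v : V // v ∉ (↑T : Set V)} => u v.1 * N v.1 ^ (-σ))
    (hup : ∀ᶠ σ : ℝ in 𝓝[>] (1 : ℝ),
      ∑' v : {v : V // v ∉ (↑T : Set V)}, u v.1 * N v.1 ^ (-σ) ≤ Real.log (1 / (σ - 1)) + C)
    (hA1 : ∀ᶠ σ : ℝ in 𝓝[>] (1 : ℝ),
      (1 - 1 / 8) * Real.log (1 / (σ - 1)) ≤ ∑' v, ‖t₁ v‖ ^ 2 * N v ^ (-(w + σ)))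
    (hA2 : ∀ᶠ σ : ℝ in 𝓝[>] (1 : ℝ),
      (1 - 1 / 8) * Real.log (1 / (σ - 1)) ≤ ∑' v, ‖t₂ v‖ ^ 2 * N v ^ (-(w + σ)))
    (hB : ∀ᶠ σ : ℝ in 𝓝[>] (1 : ℝ),
      -(1 / 8 * Real.log (1 / (σ - 1))) ≤
        ∑' v, (t₁ v * conj (t₂ v)).re * N v ^ (-(w + σ))) :
    False := by
  have hN0 : ∀ v, 0 ≤ N v := fun v => zero_le_one.trans (hN v)
  -- summability of the block moments and of the cross term, for every `σ > 1`
  have hs1 := summable_of_eventually_log_le_tsum N hN w (fun v => ‖t₁ v‖ ^ 2)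
    (fun v => sq_nonneg _) hA1
  have hs2 := summable_of_eventually_log_le_tsum N hN w (fun v => ‖t₂ v‖ ^ 2)
    (fun v => sq_nonneg _) hA2
  have hs12 : ∀ σ : ℝ, 1 < σ →
      Summable fun v => (t₁ v * conj (t₂ v)).re * N v ^ (-(w + σ)) := by
    intro σ hσ
    refine Summable.of_norm_bounded ((hs1 σ hσ).add (hs2 σ hσ)) fun v => ?_
    rw [Real.norm_eq_abs, abs_mul, abs_of_nonneg (Real.rpow_nonneg (hN0 v) _), ← add_mul]
    refine mul_le_mul_of_nonneg_right ?_ (Real.rpow_nonneg (hN0 v) _)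
    calc |(t₁ v * conj (t₂ v)).re| ≤ ‖t₁ v * conj (t₂ v)‖ := Complex.abs_re_le_norm _
      _ = ‖t₁ v‖ * ‖t₂ v‖ := by rw [norm_mul, Complex.norm_conj]
      _ ≤ ‖t₁ v‖ ^ 2 + ‖t₂ v‖ ^ 2 := by
        nlinarith [two_mul_le_add_sq ‖t₁ v‖ ‖t₂ v‖, norm_nonneg (t₁ v), norm_nonneg (t₂ v)]
  -- the two constants absorbing the finite set `T'`
  set CE : ℝ := ∑ v ∈ T', ‖t₁ v + t₂ v‖ ^ 2 * N v ^ (-(w + 1)) with hCE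
  set CT : ℝ := ∑ v ∈ T', ‖t v‖ ^ 2 * N v ^ (-(w + 1)) with hCT
  set K : ℝ := C + CT + CE with hK
  -- `L(σ) > 2 K + 1` near `1⁺`
  have hδ : (0 : ℝ) < Real.exp (-(2 * K + 1)) := Real.exp_pos _
  have hev : ∀ᶠ σ : ℝ in 𝓝[>] (1 : ℝ), False := by
    filter_upwards [hup, hA1, hA2, hB,
      Ioo_mem_nhdsGT (show (1 : ℝ) < 1 + Real.exp (-(2 * K + 1)) by linarith)]
      with σ hupσ hA1σ hA2σ hBσ hσ
    have hσ1 : 1 < σ := hσ.1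
    have hL : 2 * K + 1 < Real.log (1 / (σ - 1)) := by
      rw [Real.lt_log_iff_exp_lt (by have := hσ.1; positivity)]
      have h1 : σ - 1 < Real.exp (-(2 * K + 1)) := by linarith [hσ.2]
      have h2 := one_div_lt_one_div_of_lt (by linarith) h1
      rwa [Real.exp_neg, one_div, inv_inv] at h2
    -- the inclusion `{v ∉ T'} ↪ {v ∉ T}`
    let incl : {v : V // v ∉ T'} → {v : V // v ∉ (↑T : Set V)} :=
      fun v => ⟨v.1, fun h => v.2 (hTT' (Finset.mem_coe.mp h))⟩
    have hincl : Function.Injective incl := fun v v' h =>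
      Subtype.ext (congrArg (fun x : {v : V // v ∉ (↑T : Set V)} => x.1) h)
    -- exponent comparison on `T'`
    have hexp : ∀ v, N v ^ (-(w + σ)) ≤ N v ^ (-(w + 1)) := fun v =>
      Real.rpow_le_rpow_of_exponent_le (hN v) (by linarith)
    -- the total `F(σ) = ∑'_v |t_v|² N_v^{-(w+σ)}` and the block expansion `g`
    set F : V → ℝ := fun v => ‖t v‖ ^ 2 * N v ^ (-(w + σ)) with hF
    set g : V → ℝ := fun v => ‖t₁ v + t₂ v‖ ^ 2 * N v ^ (-(w + σ)) with hg
    have hg_eq : g = fun v => ‖t₁ v‖ ^ 2 * N v ^ (-(w + σ)) + ‖t₂ v‖ ^ 2 * N v ^ (-(w + σ)) +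
        2 * ((t₁ v * conj (t₂ v)).re * N v ^ (-(w + σ))) := by
      funext v
      simp only [hg]
      have h := Complex.normSq_add (t₁ v) (t₂ v)
      simp only [Complex.normSq_eq_norm_sq] at h
      rw [h]
      ring
    have hgsum : Summable g := by
      rw [hg_eq]
      exact ((hs1 σ hσ1).add (hs2 σ hσ1)).add ((hs12 σ hσ1).mul_left 2)
    have hG : ∑' v, g v = ∑' v, ‖t₁ v‖ ^ 2 * N v ^ (-(w + σ)) +
        ∑' v, ‖t₂ v‖ ^ 2 * N v ^ (-(w + σ)) +
        2 * ∑' v, (t₁ v * conj (t₂ v)).re * N v ^ (-(w + σ)) := by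
      rw [hg_eq, Summable.tsum_add ((hs1 σ hσ1).add (hs2 σ hσ1)) ((hs12 σ hσ1).mul_left 2),
        Summable.tsum_add (hs1 σ hσ1) (hs2 σ hσ1), tsum_mul_left]
    -- off `T'`, `F = g` and `F = u N^{-σ}`
    have hFg : ∀ v : {v : V // v ∉ T'}, F v.1 = g v.1 := fun v => by
      simp only [hF, hg, ht v.1 v.2]
    have hFu : ∀ v : {v : V // v ∉ T'}, F v.1 = u v.1 * N v.1 ^ (-σ) := fun v => hu v.1 v.2 σ
    have hFsum' : Summable fun v : {v : V // v ∉ T'} => F v.1 := by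
      have h := (husum σ hσ1).comp_injective hincl
      refine h.congr fun v => ?_
      simp only [Function.comp_apply, incl, hFu v]
    have hFsum : Summable F := (Finset.summable_compl_iff T').mp hFsum'
    -- lower bound: `F ≥ ∑' g - CE`
    have hlow : ∑' v, g v - CE ≤ ∑' v, F v := by
      rw [← hFsum.sum_add_tsum_subtype_compl T', ← hgsum.sum_add_tsum_subtype_compl T',
        tsum_congr hFg]
      have h1 : ∑ v ∈ T', g v ≤ CE :=
        Finset.sum_le_sum fun v _ => mul_le_mul_of_nonneg_left (hexp v) (sq_nonneg _)
      have h2 : 0 ≤ ∑ v ∈ T', F v :=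
        Finset.sum_nonneg fun v _ => mul_nonneg (sq_nonneg _) (Real.rpow_nonneg (hN0 v) _)
      linarith
    -- upper bound: `F ≤ CT + L + C`
    have hupp : ∑' v, F v ≤ CT + (Real.log (1 / (σ - 1)) + C) := by
      rw [← hFsum.sum_add_tsum_subtype_compl T', tsum_congr hFu]
      have h1 : ∑ v ∈ T', F v ≤ CT :=
        Finset.sum_le_sum fun v _ => mul_le_mul_of_nonneg_left (hexp v) (sq_nonneg _)
      have h2 : ∑' v : {v : V // v ∉ T'}, u v.1 * N v.1 ^ (-σ) ≤
          ∑' v : {v : V // v ∉ (↑T : Set V)}, u v.1 * N v.1 ^ (-σ) :=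
        tsum_comp_le_tsum_of_inj (husum σ hσ1)
          (fun v => mul_nonneg (hu0 v.1) (Real.rpow_nonneg (hN0 v.1) _)) hincl
      linarith
    -- combine
    rw [hG] at hlow
    linarith
  exact hev.exists.elim fun _ h => h

/-! ### §2 The route glue `IrreducibleOfMoments` -/

/-- **`IrreducibleOfMoments` (route `FrobeniusMomentIrreducibility`, support item r9, stmt-Langlands-19275):
the Rankin-type irreducibility criterion**, `MeanSquareTraceAtLeastOne → TraceCorrelationNonneg →
PairLPoleJS → IrreduciblePureCompatible`.  Given the three cruxes as hypotheses: suppose `ρ`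
(compatible with the cuspidal `π` a.e., de Rham above `ℓ`, pure of weight `w`) is reducible; part 2
gives blocks `ρ₁`, `ρ₂` (positive ranks, unramified / de Rham / pure like `ρ`,
`P_{v,ρ} = P_{v,ρ₁} P_{v,ρ₂}`, `tr ρ = tr ρ₁ + tr ρ₂`); (A), (A), (B) at `ε = 1/8` bound the block
moments below; part 1 (from `PairLPoleJS`) bounds `∑_{v ∉ T} |∑ α_P(v)|² q_v^{-σ}` above by
`log 1/(σ-1) + C`; part 2's dictionary identifies the two families off a finite set; §1 derives the
contradiction. [cite: SerreAbelianLadic1968, I.2.3] [cite: JacquetShalikaAJM1981, Prop. (3.6)] -/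
theorem irreducibleOfMoments :
    Summit.Langlands.Langlands.Theses.FrobeniusMomentIrreducibility.IrreducibleOfMoments := by
  intro hA hB hJS F _ _ n hn hcpt π ℓ _ ι ρ hcompat hdR hpure
  classical
  obtain ⟨w, hpure⟩ := hpure
  by_contra hirr
  -- the blocks of a reducible `ρ`
  obtain ⟨m, p, hm0, hp0, ρ₁, ρ₂, hur12, hdR12, hprod12⟩ :=
    exists_blocks_of_not_irreducible hn ρ hirr hdR
  have hur : ∀ᶠ v : HeightOneSpectrum (𝓞 F) in cofinite, ρ.IsUnramifiedAt v :=
    hcompat.mono fun v ⟨_, _, h, _⟩ => h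
  have hpure12 : ∀ᶠ v : HeightOneSpectrum (𝓞 F) in cofinite,
      ∀ z ∈ ((ρ₁.toGaloisRep.frobCharpoly v * ρ₂.toGaloisRep.frobCharpoly v).map
        (ι : PadicAlgCl ℓ ≃+* ℂ).toRingHom).roots, ‖z‖ = (v.residueCard : ℝ) ^ ((w : ℝ) / 2) := by
    filter_upwards [hur, hpure] with v hv hp z hz
    rw [← hprod12 v hv] at hz
    exact hp z hz
  have hpure1 : ∀ᶠ v : HeightOneSpectrum (𝓞 F) in cofinite,
      ∀ z ∈ ((ρ₁.toGaloisRep.frobCharpoly v).map (ι : PadicAlgCl ℓ ≃+* ℂ).toRingHom).roots,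
        ‖z‖ = (v.residueCard : ℝ) ^ ((w : ℝ) / 2) := by
    filter_upwards [hur, hpure12] with v hv hp z hz
    exact hp z (mem_roots_map_mul_of_mem_roots_map (monic_frobCharpoly ρ₁ (hur12 v hv).1)
      (monic_frobCharpoly ρ₂ (hur12 v hv).2) _ (Or.inl hz))
  have hpure2 : ∀ᶠ v : HeightOneSpectrum (𝓞 F) in cofinite,
      ∀ z ∈ ((ρ₂.toGaloisRep.frobCharpoly v).map (ι : PadicAlgCl ℓ ≃+* ℂ).toRingHom).roots,
        ‖z‖ = (v.residueCard : ℝ) ^ ((w : ℝ) / 2) := by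
    filter_upwards [hur, hpure12] with v hv hp z hz
    exact hp z (mem_roots_map_mul_of_mem_roots_map (monic_frobCharpoly ρ₁ (hur12 v hv).1)
      (monic_frobCharpoly ρ₂ (hur12 v hv).2) _ (Or.inr hz))
  -- the cruxes (A), (A), (B) at `ε = 1/8`
  have hA1 := hA F m hm0 ℓ ι ρ₁ w (hur.mono fun v hv => (hur12 v hv).1)
    (fun v hv => (hdR12 v hv).1) hpure1 (1 / 8) (by norm_num)
  have hA2 := hA F p hp0 ℓ ι ρ₂ w (hur.mono fun v hv => (hur12 v hv).2)
    (fun v hv => (hdR12 v hv).2) hpure2 (1 / 8) (by norm_num)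
  have hB12 := hB F m p ℓ ι ρ₁ ρ₂ w (hur.mono fun v hv => hur12 v hv) (fun v hv => hdR12 v hv)
    hpure12 (1 / 8) (by norm_num)
  -- the automorphic side (crux `PairLPoleJS`)
  obtain ⟨s, T, αP, C, hiff, hcard, hprodP, hsumm, hbound⟩ :=
    exists_unitary_normalisation_bound hn hcpt π hJS
  -- the finite exceptional set
  have hE : {v : HeightOneSpectrum (𝓞 F) | ¬ (ρ.IsUnramifiedAt v ∧
      (Summit.Langlands.SatakeFrobCompatibleAt ι π.1 ρ v ∧
        ∀ z ∈ ((ρ.toGaloisRep.frobCharpoly v).map (ι : PadicAlgCl ℓ ≃+* ℂ).toRingHom).roots,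
          ‖z‖ = (v.residueCard : ℝ) ^ ((w : ℝ) / 2)))}.Finite :=
    Filter.eventually_cofinite.mp (hur.and (hcompat.and hpure))
  have hgood : ∀ v ∉ T ∪ hE.toFinset, ρ.IsUnramifiedAt v ∧
      (Summit.Langlands.SatakeFrobCompatibleAt ι π.1 ρ v ∧
        ∀ z ∈ ((ρ.toGaloisRep.frobCharpoly v).map (ι : PadicAlgCl ℓ ≃+* ℂ).toRingHom).roots,
          ‖z‖ = (v.residueCard : ℝ) ^ ((w : ℝ) / 2)) := by
    intro v hv
    by_contra h
    exact hv (Finset.mem_union_right _ (hE.mem_toFinset.mpr h))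
  refine false_of_moment_inequalities (fun v : HeightOneSpectrum (𝓞 F) => (v.residueCard : ℝ))
    (fun v => by exact_mod_cast v.one_lt_residueCard.le) (w : ℝ)
    (fun v => (ι : PadicAlgCl ℓ ≃+* ℂ) (ρ.toGaloisRep.frobTrace v))
    (fun v => (ι : PadicAlgCl ℓ ≃+* ℂ) (ρ₁.toGaloisRep.frobTrace v))
    (fun v => (ι : PadicAlgCl ℓ ≃+* ℂ) (ρ₂.toGaloisRep.frobTrace v))
    (fun v => ‖(αP v).sum‖ ^ 2) (fun v => sq_nonneg _) T (T ∪ hE.toFinset)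
    Finset.subset_union_left C (fun v hv => ?_) (fun v hv σ => ?_) hsumm hbound hA1 hA2 hB12
  · -- traces add off the exceptional set
    have hv' := (hgood v hv).1
    simp only [frobTrace_eq_add_of_frobCharpoly_eq_mul (hur12 v hv').1 (hur12 v hv').2
      (hprod12 v hv'), map_add]
  · -- the dictionary off the exceptional set
    obtain ⟨hρur, ⟨α', hα'sat, hρur', hP⟩, hpv⟩ := hgood v hv
    have hvT : v ∉ (↑T : Set (HeightOneSpectrum (𝓞 F))) := fun h =>
      hv (Finset.mem_union_left _ (Finset.mem_coe.mp h))
    exact normSq_frobTrace_mul_rpow_eq hn ι ρ hρur' hP ((hiff v hvT α').mp hα'sat) (hcard v hvT)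
      (hprodP v hvT) hpv σ

end Summit.Langlands.Langlands.Theorems.FrobeniusMomentIrreducibilityIrreducibleOfMoments

end
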